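import Summits.Ventures.HodgeRepro2.A2HodgeNumbers

/-!
# A2HodgeSymmetry — the swap `a_p ↔ b_p` is an automorphism of the model exchanging the two
bidegrees: `σ(hgrading a b) = hgrading b a`

Tier-4 annex of sub-claim A2 (seat p6, cell pub-hodge-repro2); §8(d): uses an L-value-free
non-vanishing device: NO.

The model `A ι = ⋀ V ι` carries the involution `swapGen : (p, s) ↦ (p, !s)` of its generators,
hence a linear involution `swapV` of `V ι` and an algebra automorphism `swapA` of the model
(`ExteriorAlgebra.map`).  It is the LINEAR part of complex conjugation on `H^*(B, ℂ)` in the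
eigenform basis (`ℓ_{τ} ↔ ℓ_{τ̄}`, A4.2 / A0.3 (iii)); the antilinear part (conjugation of the
coefficients) is not in the model.  Recorded here:

* `swapA_gen`, `swapA_mono`, `swapA_swapA` (an involution), `swapA_E` / `swapA_theta`
  (`E_p = a_p ∧ b_p ↦ b_p ∧ a_p = −E_p`, so `θ ↦ −θ`: the (1,1)-class is ANTI-invariant under the
  linear swap — the real form is `i θ`, as for the Kähler form `(i/2) Σ dz ∧ dz̄`);
* `map_hgrading`: `swapA (hgrading a b) = hgrading b a` — THE HODGE SYMMETRY of the model's
  bigrading (row 122), with `finrank_hgrading_symm'` re-deriving `h^{a,b} = h^{b,a}` (row 123)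
  structurally.

What stays prose: the identification of the model's bigrading with the Hodge decomposition of
`H^*(B, ℂ)` and of `swapA` with the linear part of complex conjugation; not on the N1 chain.
-/

namespace Summit.Ventures.HodgeRepro2.A2HodgeSymmetry

open WeilPlanes WeilIntegral WeilCoproduct A2ModelDuality A2HodgeTypeModel A2HodgeBigrading

variable {ι : Type*} [DecidableEq ι]

/-- The swap of the two generators of every plane, `(p, s) ↦ (p, !s)`. -/
def swapGen : Gen ι ≃ Gen ι where
  toFun j := (j.1, !j.2)
  invFun j := (j.1, !j.2)
  left_inv j := by simp
  right_inv j := by simp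

omit [DecidableEq ι] in
/-- `swapGen (p, s) = (p, !s)`. -/
theorem swapGen_apply (p : ι) (s : Bool) : swapGen (p, s) = (p, !s) := rfl

omit [DecidableEq ι] in
/-- `swapGen` is an involution. -/
theorem swapGen_swapGen (j : Gen ι) : swapGen (swapGen j) = j := by
  obtain ⟨p, s⟩ := j
  simp [swapGen_apply]

omit [DecidableEq ι] in
/-- `swapGen.symm = swapGen`. -/
theorem swapGen_symm : (swapGen : Gen ι ≃ Gen ι).symm = swapGen := rfl

/-- The induced linear involution of `V ι` (pre-composition with the swap). -/
def swapV : V ι ≃ₗ[ℂ] V ι := LinearEquiv.funCongrLeft ℂ ℂ swapGen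

omit [DecidableEq ι] in
/-- `swapV v j = v (swapGen j)`. -/
theorem swapV_apply (v : V ι) (j : Gen ι) : swapV v j = v (swapGen j) := rfl

/-- `swapV` sends the basis vector of `j` to the basis vector of `swapGen j`. -/
theorem swapV_single (j : Gen ι) : swapV (Pi.single j (1 : ℂ)) = Pi.single (swapGen j) 1 := by
  ext k
  rw [swapV_apply, Pi.single_apply, Pi.single_apply]
  have : swapGen k = j ↔ k = swapGen j := by
    constructor
    · rintro rfl
      rw [swapGen_swapGen]
    · rintro rfl
      rw [swapGen_swapGen]
  simp only [this]

/-- The algebra automorphism of the model swapping `a_p ↔ b_p`. -/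
def swapA : A ι →ₐ[ℂ] A ι := ExteriorAlgebra.map swapV.toLinearMap

/-- `swapA (gen j) = gen (swapGen j)`. -/
theorem swapA_gen (j : Gen ι) : swapA (gen j) = gen (swapGen j) := by
  show ExteriorAlgebra.map swapV.toLinearMap (ExteriorAlgebra.ι ℂ (Pi.single j 1)) =
    ExteriorAlgebra.ι ℂ (Pi.single (swapGen j) 1)
  rw [ExteriorAlgebra.map_apply_ι, LinearEquiv.coe_coe, swapV_single]

/-- `swapA (mono l) = mono (l.map swapGen)`. -/
theorem swapA_mono (l : List (Gen ι)) : swapA (mono l) = mono (l.map swapGen) := by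
  simp only [mono]
  rw [map_list_prod, List.map_map, List.map_map]
  congr 1
  exact List.map_congr_left fun j _ => swapA_gen j

omit [DecidableEq ι] in
/-- `swapA` is an involution. -/
theorem swapA_swapA (x : A ι) : swapA (swapA x) = x := by
  have h : (swapA.comp swapA : A ι →ₐ[ℂ] A ι) = AlgHom.id ℂ (A ι) := by
    refine ExteriorAlgebra.hom_ext (LinearMap.ext fun v => ?_)
    simp only [LinearMap.comp_apply, AlgHom.toLinearMap_apply, AlgHom.comp_apply, AlgHom.id_apply]
    simp only [swapA, ExteriorAlgebra.map_apply_ι, LinearEquiv.coe_coe]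
    congr 1
    ext j
    rw [swapV_apply, swapV_apply, swapGen_swapGen]
  exact AlgHom.congr_fun h x

omit [DecidableEq ι] in
/-- `swapA` is injective. -/
theorem swapA_injective : Function.Injective (swapA : A ι → A ι) :=
  Function.LeftInverse.injective swapA_swapA

/-- `E_p ↦ −E_p`: the full-plane class is anti-invariant under the linear swap. -/
theorem swapA_E (p : ι) : swapA (E p) = -E p := by
  show swapA (gen (p, false) * gen (p, true)) = -(gen (p, false) * gen (p, true))
  rw [map_mul, swapA_gen, swapA_gen, swapGen_apply, swapGen_apply, Bool.not_false, Bool.not_true,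
    gen_mul_gen_swap]

/-- `θ ↦ −θ` for every `θ = Σ c_p E_p` (hence `swapA (θ^k) = (−1)^k θ^k`). -/
theorem swapA_theta [Fintype ι] (c : ι → ℂ) : swapA (theta c) = -theta c := by
  simp only [theta, map_sum, map_smul, swapA_E, smul_neg, Finset.sum_neg_distrib]

omit [DecidableEq ι] in
/-- The counts are exchanged by the swap. -/
theorem cA_map_swapGen (l : List (Gen ι)) : cA (l.map swapGen) = cB l := by
  simp only [cA, cB, List.countP_map]
  congr 1
  funext j
  simp [swapGen]

omit [DecidableEq ι] in
/-- The counts are exchanged by the swap. -/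
theorem cB_map_swapGen (l : List (Gen ι)) : cB (l.map swapGen) = cA l := by
  simp only [cA, cB, List.countP_map]
  rfl

/-- THE HODGE SYMMETRY OF THE MODEL: `swapA (hgrading a b) = hgrading b a`. -/
theorem map_hgrading (a b : ℕ) :
    (hgrading a b : Submodule ℂ (A ι)).map swapA.toLinearMap = hgrading b a := by
  apply le_antisymm
  · rw [Submodule.map_le_iff_le_comap]
    refine Submodule.span_le.mpr ?_
    rintro x ⟨l, ha, hb, rfl⟩
    rw [SetLike.mem_coe, Submodule.mem_comap, AlgHom.toLinearMap_apply, swapA_mono, ← hb, ← ha,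
      ← cA_map_swapGen l, ← cB_map_swapGen l]
    exact mono_mem_hgrading _
  · refine Submodule.span_le.mpr ?_
    rintro x ⟨l, hb, ha, rfl⟩
    rw [SetLike.mem_coe, Submodule.mem_map]
    refine ⟨mono (l.map swapGen), ?_, ?_⟩
    · rw [← ha, ← hb, ← cA_map_swapGen l, ← cB_map_swapGen l]
      exact mono_mem_hgrading _
    · rw [AlgHom.toLinearMap_apply, swapA_mono, List.map_map]
      congr 1
      exact (List.map_congr_left fun j _ => swapGen_swapGen j).trans (List.map_id l)

/-- `swapA` as a linear equivalence (an involution). -/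
def swapAEquiv : A ι ≃ₗ[ℂ] A ι :=
  LinearEquiv.ofInvolutive swapA.toLinearMap swapA_swapA

omit [DecidableEq ι] in
/-- `swapAEquiv x = swapA x`. -/
theorem swapAEquiv_apply (x : A ι) : swapAEquiv x = swapA x := rfl

/-- `h^{a,b} = h^{b,a}` re-derived from the Hodge symmetry `swapA (hgrading a b) = hgrading b a`
(row 123's `finrank_hgrading_symm` obtained it from the count). -/
theorem finrank_hgrading_symm' [Fintype ι] (a b : ℕ) :
    Module.finrank ℂ (hgrading (ι := ι) a b) = Module.finrank ℂ (hgrading (ι := ι) b a) := by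
  rw [← map_hgrading a b]
  exact (LinearEquiv.finrank_map_eq (swapAEquiv : A ι ≃ₗ[ℂ] A ι) (hgrading a b)).symm

end Summit.Ventures.HodgeRepro2.A2HodgeSymmetry
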